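import Summits.ABC.ABC.Theses.AntisymmetricTwoTorsion
import HarnessLib

/-!
# Crux `TraceDefectPayoff` (stmt-ABC-23395), line `birth` — stub `stub_classTripleBound`

Registered stub `stub_classTripleBound` of the birth skeleton of crux stmt-ABC-23395 (route
`AntisymmetricTwoTorsion`, abc-idea-1 g2): **Pasten–Sepúlveda-Manzo 2025 Thm 2.2 on the
antisymmetric two-torsion class.** Given the engine `RadAFreeEngine`
(`= PastenSepulvedaManzo2025_thm_2_2`: `log (c/a) / log⁎₂ c ≤ exp (κ · psRate (rad (bc)))` for all
coprime `a + b = c`), for every `ε > 0` there is `C` with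

  `log M ≤ 4 log (1 + |a|) + C · rad (b (a² − 4b)) ^ ε`,  `M = max (4|b|, |a² − 4b|)`,

for all coprime `a, b` with `b (a² − 4b) ≠ 0` and NOT (`b > 0 ∧ a² − 4b > 0`).

Proof (the planner's TripleReduction + DefectAbsorption). TRIPLE (`exists_abcTriple`): with
`D = a² − 4b`, `X = M − a²`: if `b < 0` then `M = D > 0`, `X = 4|b|`; if `b > 0` then `D < 0`,
`M = 4b`, `X = |D|`; so `a² + X = M`, `X M = 4 |b| |D|`, every common divisor of `a², X` divides
`4b`, hence `g = gcd (a², X) ∣ 4`; the coprime triple is `(a²/g) + (X/g) = (M/g)` (`a ≠ 0`), with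
`M ≤ 4 (M/g)` and `rad ((X/g)(M/g)) ≤ 2 rad (bD)`. RATE (`exists_exp_mul_psRate_le`):
`exp (κ psRate R) ≤ C₁ R ^ ε` for naturals `R ≥ 1` (`psRate R ≤ log R`, and `≤ δ log R` once
`log log R ≥ y₀ (δ)` by `log = o (id)`, Mathlib `Real.isLittleO_log_id_atTop`). ABSORPTION
(`absorb`): `ℓ − A ≤ max (1, log ℓ) T`, `T ≥ 1`, `A ≥ 0` ⇒ `ℓ ≤ 2A + 16 T²` (`log ℓ ≤ 2 √ℓ`).
ASSEMBLY: Thm 2.2 on the triple at `ε/2`, absorption with `A = log (a²/g) ≤ 2 log |a|`,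
`log M ≤ log 4 + log (M/g)`; `C = 16 C₁² 2 ^ ε + log 4` (also covers `a = 0`: `b = ±1`, `M = 4`).

HONESTY. Bookkeeping around a 2025 linear-forms-in-logarithms theorem (proved in the tree from
rung A1.L); the class corollary it serves (`TraceDefectSubexpSzpiro`, rung A1′ up to a trace defect
on a thin class) is NOT abc and NOT A-PS; moves no rung.
Reference: H. Pasten, R. Sepúlveda-Manzo, *On the abc and the abcd conjectures*, Bull. Braz.
Math. Soc. 56 (2025) = arXiv:2406.05083, Thm 2.2. [PastenSepulvedaManzo2025Abcd]
-/

-- `Summit.<Summit>.<Problem>` is the mandated summit-side namespace (CONVENTIONS §2); for the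
-- single-conjunct summit `ABC` the two coincide, so the duplicate `ABC.ABC` is deliberate.
set_option linter.dupNamespace false

namespace Summit.ABC.ABC.Theorems.TraceDefectPayoffLine

open UniqueFactorizationMonoid Filter
open Literature.NumberTheory.DiophantineGeometry Literature.NumberTheory.DiophantineGeometry.Dioph
open Summit.ABC.ABC.Theses.AntisymmetricTwoTorsion

/-- `log y ≤ max (1, y)` for `y > −1` (for `−1 < y < 0`, `log y = log (−y) < 0`). [folklore] -/
theorem log_le_max_one_self {y : ℝ} (hy : -1 < y) : Real.log y ≤ max 1 y := by
  rcases lt_trichotomy y 0 with h | rfl | h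
  · have h1 : Real.log y < 0 := by
      rw [← Real.log_neg_eq_log]
      exact Real.log_neg (by linarith) (by linarith)
    exact h1.le.trans (zero_le_one.trans (le_max_left _ _))
  · simp
  · exact ((Real.log_le_sub_one_of_pos h).trans (by linarith)).trans (le_max_right _ _)

/-- For a natural number `R ≥ 2`: `−1 < log log R` (as `log R ≥ log 2 > e⁻¹`). [folklore] -/
theorem neg_one_lt_log_log {R : ℕ} (hR : 2 ≤ R) : -1 < Real.log (Real.log (R : ℝ)) := by
  have hR' : (2 : ℝ) ≤ R := by exact_mod_cast hR
  have hL : Real.log 2 ≤ Real.log (R : ℝ) := Real.log_le_log two_pos hR'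
  have h1 : Real.exp (-1) < Real.log 2 := by
    rw [Real.exp_neg]
    have he := Real.exp_one_gt_d9
    have hl := Real.log_two_gt_d9
    have h2 : (Real.exp 1)⁻¹ < (2.7182818283 : ℝ)⁻¹ := by
      rw [inv_lt_inv₀ (Real.exp_pos 1) (by norm_num)]
      exact he
    have h3 : (2.7182818283 : ℝ)⁻¹ < 0.6931471803 := by norm_num
    linarith
  have h2 : Real.exp (-1) < Real.log (R : ℝ) := h1.trans_le hL
  have h3 := Real.log_lt_log (Real.exp_pos _) h2
  rwa [Real.log_exp] at h3

/-- `psRate R ≤ log R` for every natural `R ≥ 2`: the ratio `log⁎₃ R / log⁎₂ R` is at most `1`.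
[cite: PastenSepulvedaManzo2025Abcd, display (2.1)] -/
theorem psRate_le_log {R : ℕ} (hR : 2 ≤ R) : psRate (R : ℝ) ≤ Real.log (R : ℝ) := by
  rw [psRate_def, logStar_def, logStar_def]
  set L := Real.log (R : ℝ) with hLdef
  set y := Real.log L with hydef
  have hL : 0 ≤ L := Real.log_nonneg (by exact_mod_cast (show 1 ≤ R by omega))
  have hy : -1 < y := neg_one_lt_log_log hR
  have hden : 0 < max 1 y := lt_of_lt_of_le one_pos (le_max_left _ _)
  have hnum : max 1 (Real.log y) ≤ max 1 y :=
    max_le (le_max_left _ _) (log_le_max_one_self hy)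
  have hratio : max 1 (Real.log y) / max 1 y ≤ 1 := (div_le_one hden).mpr hnum
  calc max 1 (Real.log y) / max 1 y * L ≤ 1 * L := mul_le_mul_of_nonneg_right hratio hL
    _ = L := one_mul L

/-- `psRate R ≤ δ · log R` as soon as `log log R ≥ y₀ (δ)` (`log = o (id)` at `+∞`).
[cite: PastenSepulvedaManzo2025Abcd, display (2.1)] -/
theorem exists_psRate_le_mul_log {δ : ℝ} (hδ : 0 < δ) :
    ∃ y₀ : ℝ, ∀ R : ℕ, 2 ≤ R → y₀ ≤ Real.log (Real.log (R : ℝ)) →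
      psRate (R : ℝ) ≤ δ * Real.log (R : ℝ) := by
  obtain ⟨y₁, hy₁⟩ := Filter.eventually_atTop.mp (Real.isLittleO_log_id_atTop.bound hδ)
  refine ⟨max y₁ (max 1 (1 / δ)), fun R hR hy => ?_⟩
  rw [psRate_def, logStar_def, logStar_def]
  set L := Real.log (R : ℝ) with hLdef
  set y := Real.log L with hydef
  have hL : 0 ≤ L := Real.log_nonneg (by exact_mod_cast (show 1 ≤ R by omega))
  have hy1 : 1 ≤ y := ((le_max_left _ _).trans (le_max_right _ _)).trans hy
  have hyδ : 1 / δ ≤ y := ((le_max_right _ _).trans (le_max_right _ _)).trans hy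
  have hy0 : 0 < y := by linarith
  have hlog : Real.log y ≤ δ * y := by
    have h := hy₁ y ((le_max_left _ _).trans hy)
    simp only [id, Real.norm_eq_abs] at h
    rw [abs_of_pos hy0] at h
    exact (le_abs_self _).trans h
  have h1δ : 1 ≤ δ * y := by
    have := mul_le_mul_of_nonneg_left hyδ hδ.le
    rwa [mul_one_div_cancel hδ.ne'] at this
  have hnum : max 1 (Real.log y) ≤ δ * y := max_le h1δ hlog
  rw [max_eq_right hy1]
  calc max 1 (Real.log y) / y * L ≤ δ * y / y * L := by gcongr
    _ = δ * L := by rw [mul_div_assoc, div_self hy0.ne', mul_one]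

/-- **The rate is `R ^ o(1)`**: for `κ, ε > 0` there is `C₁ ≥ 1` with
`exp (κ · psRate R) ≤ C₁ · R ^ ε` for every natural `R ≥ 1`.
[cite: PastenSepulvedaManzo2025Abcd, Thm 1.3 ("in particular")] -/
theorem exists_exp_mul_psRate_le {κ ε : ℝ} (hκ : 0 < κ) (hε : 0 < ε) :
    ∃ C₁ : ℝ, 1 ≤ C₁ ∧ ∀ R : ℕ, 1 ≤ R → Real.exp (κ * psRate (R : ℝ)) ≤ C₁ * (R : ℝ) ^ ε := by
  obtain ⟨y₀, hy₀⟩ := exists_psRate_le_mul_log (div_pos hε hκ)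
  have hC : 1 ≤ Real.exp (κ * Real.exp y₀) := Real.one_le_exp (by positivity)
  refine ⟨Real.exp (κ * Real.exp y₀), hC, fun R hR => ?_⟩
  have hR0 : (0 : ℝ) < R := by exact_mod_cast (show 0 < R by omega)
  have hRε : 1 ≤ (R : ℝ) ^ ε := Real.one_le_rpow (by exact_mod_cast hR) hε.le
  rcases eq_or_lt_of_le hR with h1 | hR2
  · -- `R = 1`: `psRate 1 = 0`
    subst h1
    have h0 : psRate ((1 : ℕ) : ℝ) = 0 := by rw [psRate_def]; simp
    rw [h0, mul_zero, Real.exp_zero]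
    nlinarith
  · have hR2' : 2 ≤ R := hR2
    by_cases hy : y₀ ≤ Real.log (Real.log (R : ℝ))
    · have h1 : κ * psRate (R : ℝ) ≤ ε * Real.log R := by
        have h := mul_le_mul_of_nonneg_left (hy₀ R hR2' hy) hκ.le
        have hκε : κ * (ε / κ) = ε := by field_simp
        calc κ * psRate (R : ℝ) ≤ κ * (ε / κ * Real.log R) := h
          _ = ε * Real.log R := by rw [← mul_assoc, hκε]
      calc Real.exp (κ * psRate R) ≤ Real.exp (ε * Real.log R) := Real.exp_le_exp.mpr h1
        _ = (R : ℝ) ^ ε := by rw [Real.rpow_def_of_pos hR0, mul_comm]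
        _ ≤ Real.exp (κ * Real.exp y₀) * R ^ ε := le_mul_of_one_le_left (by positivity) hC
    · push Not at hy
      have hL0 : 0 < Real.log (R : ℝ) := Real.log_pos (by exact_mod_cast hR2)
      have h1 : psRate (R : ℝ) ≤ Real.log R := psRate_le_log hR2'
      have h2 : Real.log (R : ℝ) < Real.exp y₀ := by
        have := Real.exp_lt_exp.mpr hy
        rwa [Real.exp_log hL0] at this
      have h3 : κ * psRate (R : ℝ) ≤ κ * Real.exp y₀ := by nlinarith
      calc Real.exp (κ * psRate R) ≤ Real.exp (κ * Real.exp y₀) := Real.exp_le_exp.mpr h3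
        _ ≤ Real.exp (κ * Real.exp y₀) * R ^ ε := le_mul_of_one_le_right (by positivity) hRε

/-- **Defect absorption**: `ℓ − A ≤ max (1, log ℓ) · T` with `A ≥ 0`, `T ≥ 1`, `ℓ ≥ 0` forces
`ℓ ≤ 2A + 16 T²` (either `max (1, log ℓ) T ≤ ℓ/2`, or `ℓ < 2T`, or `ℓ/2 < T log ℓ ≤ 2T √ℓ`).
[folklore] -/
theorem absorb {ℓ A T : ℝ} (hA : 0 ≤ A) (hT : 1 ≤ T) (hℓ : 0 ≤ ℓ)
    (h : ℓ - A ≤ max 1 (Real.log ℓ) * T) : ℓ ≤ 2 * A + 16 * T ^ 2 := by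
  have hT2 : 0 ≤ 16 * T ^ 2 := by positivity
  by_cases h1 : max 1 (Real.log ℓ) * T ≤ ℓ / 2
  · linarith
  · have h2 : ℓ / 2 < max 1 (Real.log ℓ) * T := lt_of_not_ge h1
    by_cases h3 : Real.log ℓ ≤ 1
    · rw [max_eq_left h3] at h2
      nlinarith
    · have h4 : 1 < Real.log ℓ := lt_of_not_ge h3
      rw [max_eq_right h4.le] at h2
      -- `log ℓ ≤ 2 √ℓ`
      have h5 : Real.log ℓ ≤ 2 * Real.sqrt ℓ := by
        have h := Real.log_le_rpow_div hℓ (by norm_num : (0 : ℝ) < 1 / 2)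
        rw [← Real.sqrt_eq_rpow] at h
        linarith
      set s := Real.sqrt ℓ with hs
      have hs0 : 0 ≤ s := Real.sqrt_nonneg ℓ
      have hℓs : ℓ = s ^ 2 := (Real.sq_sqrt hℓ).symm
      have h6 : s ^ 2 < 4 * T * s := by nlinarith
      have hspos : 0 < s := by
        rcases eq_or_lt_of_le hs0 with h0 | h0
        · rw [← h0] at h6; norm_num at h6
        · exact h0
      have h7 : s < 4 * T := by nlinarith
      have h8 : s ^ 2 < 16 * T ^ 2 := by nlinarith
      linarith

/-- Sign analysis on the antisymmetric class: with `D = a² − 4b`, `M = max (4|b|, |D|)` and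
`X = M − a²` one has `X > 0`, `X · M = 4 |b| |D|`, and every common divisor of `a²` and `X`
divides `4b`. [folklore] -/
theorem sign_cases {a b : ℤ} (hb : b ≠ 0) (hd : a ^ 2 - 4 * b ≠ 0)
    (hsign : ¬ (0 < b ∧ 0 < a ^ 2 - 4 * b)) :
    0 < max (4 * |b|) |a ^ 2 - 4 * b| - a ^ 2 ∧
      (max (4 * |b|) |a ^ 2 - 4 * b| - a ^ 2) * max (4 * |b|) |a ^ 2 - 4 * b| =
        4 * |b| * |a ^ 2 - 4 * b| ∧
      ∀ d : ℤ, d ∣ a ^ 2 → d ∣ max (4 * |b|) |a ^ 2 - 4 * b| - a ^ 2 → d ∣ 4 * b := by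
  have ha2 : 0 ≤ a ^ 2 := sq_nonneg a
  rcases lt_or_gt_of_ne hb with hb' | hb'
  · -- `b < 0`: `D > 0`, `M = D`, `X = −4b`
    have hDpos : 0 < a ^ 2 - 4 * b := by linarith
    have hM : max (4 * |b|) |a ^ 2 - 4 * b| = a ^ 2 - 4 * b := by
      rw [abs_of_neg hb', abs_of_pos hDpos]
      exact max_eq_right (by linarith)
    rw [hM]
    refine ⟨by linarith, ?_, fun d _ hdX => ?_⟩
    · rw [abs_of_neg hb', abs_of_pos hDpos]; ring
    · have h1 : a ^ 2 - 4 * b - a ^ 2 = -(4 * b) := by ring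
      rw [h1] at hdX
      exact dvd_neg.mp hdX
  · -- `b > 0`: `D < 0`, `M = 4b`, `X = 4b − a²`
    have hDneg : a ^ 2 - 4 * b < 0 :=
      lt_of_le_of_ne (not_lt.mp fun h => hsign ⟨hb', h⟩) hd
    have hM : max (4 * |b|) |a ^ 2 - 4 * b| = 4 * b := by
      rw [abs_of_pos hb', abs_of_neg hDneg]
      exact max_eq_left (by linarith)
    rw [hM]
    refine ⟨by linarith, ?_, fun d hda hdX => ?_⟩
    · rw [abs_of_pos hb', abs_of_neg hDneg]; ring
    · have h1 := dvd_add hdX hda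
      have h2 : 4 * b - a ^ 2 + a ^ 2 = 4 * b := by ring
      rwa [h2] at h1

/-- **Triple reduction**: for coprime `a, b` with `a ≠ 0`, `b (a² − 4b) ≠ 0` and NOT
(`b > 0 ∧ a² − 4b > 0`), there is an abc triple `A + X = M` in `ℕ` with `A ∣ a²`,
`max (4|b|, |a² − 4b|) ≤ 4M` and `X · M ∣ 4 b (a² − 4b)` — namely `(a², M − a², M)` divided by
`g = gcd (a², M − a²) ∣ 4`. [folklore] -/
theorem exists_abcTriple {a b : ℤ} (hab : IsCoprime a b) (hb : b ≠ 0) (hd : a ^ 2 - 4 * b ≠ 0)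
    (hsign : ¬ (0 < b ∧ 0 < a ^ 2 - 4 * b)) (ha : a ≠ 0) :
    ∃ A X M : ℕ, IsABCTriple A X M ∧ (A : ℤ) ∣ a ^ 2 ∧
      (max (4 * |b|) |a ^ 2 - 4 * b| : ℤ) ≤ 4 * (M : ℤ) ∧
      X * M ∣ (4 * (b * (a ^ 2 - 4 * b))).natAbs := by
  obtain ⟨hXpos, hXM, hdiv⟩ := sign_cases hb hd hsign
  set Mz : ℤ := max (4 * |b|) |a ^ 2 - 4 * b| with hMz
  set Xz : ℤ := Mz - a ^ 2 with hXz
  have ha2pos : 0 < a ^ 2 := by positivity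
  have hMpos : 0 < Mz := by linarith
  set A₀ : ℕ := (a ^ 2).natAbs with hA₀def
  set X₀ : ℕ := Xz.natAbs with hX₀def
  set M₀ : ℕ := Mz.natAbs with hM₀def
  have hA₀ : (A₀ : ℤ) = a ^ 2 := Int.natAbs_of_nonneg ha2pos.le
  have hX₀ : (X₀ : ℤ) = Xz := Int.natAbs_of_nonneg hXpos.le
  have hM₀ : (M₀ : ℤ) = Mz := Int.natAbs_of_nonneg hMpos.le
  have hsum : A₀ + X₀ = M₀ := by
    zify
    rw [hA₀, hX₀, hM₀, hXz]
    ring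
  have hA₀pos : 0 < A₀ := Int.natAbs_pos.mpr ha2pos.ne'
  have hX₀pos : 0 < X₀ := Int.natAbs_pos.mpr hXpos.ne'
  set g : ℕ := Nat.gcd A₀ X₀ with hg
  have hgpos : 0 < g := Nat.gcd_pos_of_pos_left _ hA₀pos
  have hgA : g ∣ A₀ := Nat.gcd_dvd_left _ _
  have hgX : g ∣ X₀ := Nat.gcd_dvd_right _ _
  have hgM : g ∣ M₀ := hsum ▸ dvd_add hgA hgX
  have hg4 : g ∣ 4 := by
    have h1 : (g : ℤ) ∣ a ^ 2 := by rw [← hA₀]; exact Int.natCast_dvd_natCast.mpr hgA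
    have h2 : (g : ℤ) ∣ Xz := by rw [← hX₀]; exact Int.natCast_dvd_natCast.mpr hgX
    have h3 : (g : ℤ) ∣ 4 * b := hdiv _ h1 h2
    have hcop : IsCoprime (g : ℤ) b := (hab.pow_left (m := 2)).of_isCoprime_of_dvd_left h1
    have h4 : (g : ℤ) ∣ 4 := hcop.dvd_of_dvd_mul_right h3
    exact_mod_cast h4
  refine ⟨A₀ / g, X₀ / g, M₀ / g, ⟨?_, ?_, ?_, ?_⟩, ?_, ?_, ?_⟩
  · exact Nat.div_pos (Nat.le_of_dvd hA₀pos hgA) hgpos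
  · exact Nat.div_pos (Nat.le_of_dvd hX₀pos hgX) hgpos
  · rw [← hsum, Nat.add_div_of_dvd_right hgA]
  · exact Nat.coprime_div_gcd_div_gcd hgpos
  · rw [← hA₀]
    exact Int.natCast_dvd_natCast.mpr (Nat.div_dvd_of_dvd hgA)
  · have h1 : M₀ = g * (M₀ / g) := (Nat.mul_div_cancel' hgM).symm
    have hle : M₀ ≤ 4 * (M₀ / g) := by
      calc M₀ = g * (M₀ / g) := h1
        _ ≤ 4 * (M₀ / g) := Nat.mul_le_mul_right _ (Nat.le_of_dvd (by norm_num) hg4)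
    rw [← hM₀]
    exact_mod_cast hle
  · have h1 : X₀ / g * (M₀ / g) ∣ X₀ * M₀ :=
      mul_dvd_mul (Nat.div_dvd_of_dvd hgX) (Nat.div_dvd_of_dvd hgM)
    have h2 : X₀ * M₀ = (4 * (b * (a ^ 2 - 4 * b))).natAbs := by
      have h3 : (Xz * Mz).natAbs = (4 * |b| * |a ^ 2 - 4 * b|).natAbs := by rw [hXM]
      rw [Int.natAbs_mul] at h3
      rw [h3]
      simp [Int.natAbs_mul, Int.natAbs_abs, mul_assoc]
    exact h2 ▸ h1

/-- `rad 4 = 2` in `ℕ`. [folklore] -/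
theorem radical_four : radical (4 : ℕ) = 2 := by
  rw [show (4 : ℕ) = 2 ^ 2 by norm_num, radical_pow_of_prime Nat.prime_two.prime two_ne_zero]
  rfl

/-- If `X · M ∣ 4n` (`n ≠ 0`) then `rad (X M) ≤ 2 · rad (n)` (as real numbers; `rad (4 m) ∣
rad 4 · rad m = 2 rad m`). [folklore] -/
theorem cast_radical_le {X M : ℕ} {n : ℤ} (hn : n ≠ 0) (h : X * M ∣ (4 * n).natAbs) :
    ((radical (X * M) : ℕ) : ℝ) ≤ 2 * (((radical n).natAbs : ℕ) : ℝ) := by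
  have h4n : (4 * n).natAbs = 4 * n.natAbs := by rw [Int.natAbs_mul]; rfl
  have hn' : n.natAbs ≠ 0 := Int.natAbs_ne_zero.mpr hn
  have hne : (4 * n).natAbs ≠ 0 := by rw [h4n]; positivity
  have h1 : radical (X * M) ∣ radical ((4 * n).natAbs) := radical_dvd_radical h hne
  rw [h4n] at h1
  have h2 : radical (4 * n.natAbs) ∣ radical 4 * radical n.natAbs := radical_mul_dvd
  rw [radical_four] at h2
  have h3 : radical (X * M) ∣ 2 * radical n.natAbs := h1.trans h2
  have hr : (radical n).natAbs = radical n.natAbs := by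
    rw [← Int.radical_natAbs_eq_radical, Int.natAbs_natCast]
  rw [hr]
  have hpos : 0 < 2 * radical n.natAbs := by
    have : radical n.natAbs ≠ 0 := radical_ne_zero
    positivity
  exact_mod_cast Nat.le_of_dvd hpos h3

/-- **Stub `stub_classTripleBound` of line `birth` (crux stmt-ABC-23395).** Pasten–Sepúlveda-Manzo
Thm 2.2 on the antisymmetric class: for every `ε > 0` there is `C` with
`log max (4|b|, |a² − 4b|) ≤ 4 log (1 + |a|) + C · rad (b (a² − 4b)) ^ ε` for all coprime `a, b`
with `b (a² − 4b) ≠ 0` and NOT (`b > 0 ∧ a² − 4b > 0`); `C = 16 C₁ (κ, ε/2)² 2 ^ ε + log 4`.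
[cite: PastenSepulvedaManzo2025Abcd, Thm 2.2] -/
theorem stub_classTripleBound : RadAFreeEngine → ∀ ε : ℝ, 0 < ε → ∃ C : ℝ, ∀ a b : ℤ, IsCoprime a b → b ≠ 0 → a ^ 2 - 4 * b ≠ 0 → ¬ (0 < b ∧ 0 < a ^ 2 - 4 * b) → Real.log ((max (4 * |b|) |a ^ 2 - 4 * b| : ℤ) : ℝ) ≤ 4 * Real.log (1 + |(a : ℝ)|) + C * (((radical (b * (a ^ 2 - 4 * b))).natAbs : ℕ) : ℝ) ^ ε := by
  intro hE ε hε
  obtain ⟨κ, hκ, hthm⟩ := hE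
  obtain ⟨C₁, hC₁, hrate⟩ := exists_exp_mul_psRate_le hκ (half_pos hε)
  have hlog4 : 0 ≤ Real.log 4 := Real.log_nonneg (by norm_num)
  have hCnonneg : 0 ≤ 16 * C₁ ^ 2 * (2 : ℝ) ^ ε := by positivity
  refine ⟨16 * C₁ ^ 2 * (2 : ℝ) ^ ε + Real.log 4, ?_⟩
  intro a b hab hb hd hsign
  set n : ℤ := b * (a ^ 2 - 4 * b) with hn
  have hn0 : n ≠ 0 := mul_ne_zero hb hd
  set r : ℕ := (radical n).natAbs with hr
  have hr1 : 1 ≤ (r : ℝ) := by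
    have : r ≠ 0 := Int.natAbs_ne_zero.mpr radical_ne_zero
    exact_mod_cast Nat.one_le_iff_ne_zero.mpr this
  have hrε : 1 ≤ (r : ℝ) ^ ε := Real.one_le_rpow hr1 hε.le
  rcases eq_or_ne a 0 with ha | ha
  · -- `a = 0`: `b = ±1`, `M = 4`
    subst ha
    have hbu : IsUnit b := isCoprime_zero_left.mp hab
    have hM : (max (4 * |b|) |(0 : ℤ) ^ 2 - 4 * b| : ℤ) = 4 := by
      rcases Int.isUnit_iff.mp hbu with rfl | rfl <;> norm_num
    rw [hM]
    simp only [Int.cast_zero, abs_zero, add_zero, Real.log_one, mul_zero, zero_add, Int.cast_ofNat]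
    calc Real.log 4 ≤ (16 * C₁ ^ 2 * (2 : ℝ) ^ ε + Real.log 4) * 1 := by linarith
      _ ≤ (16 * C₁ ^ 2 * (2 : ℝ) ^ ε + Real.log 4) * (r : ℝ) ^ ε :=
          mul_le_mul_of_nonneg_left hrε (by positivity)
  · obtain ⟨A, X, M, ⟨hA, hX, hAXM, hcop⟩, hAdvd, hMle, hXM⟩ :=
      exists_abcTriple hab hb hd hsign ha
    -- Thm 2.2 on the triple, and the rate
    have h22 := hthm A X M ⟨hA, hX, hAXM, hcop⟩
    set R : ℕ := radical (X * M) with hR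
    have hR1 : 1 ≤ R := Nat.one_le_iff_ne_zero.mpr radical_ne_zero
    have hE1 : Real.exp (κ * psRate (R : ℝ)) ≤ C₁ * (R : ℝ) ^ (ε / 2) := hrate R hR1
    have hRle : (R : ℝ) ≤ 2 * r := cast_radical_le hn0 hXM
    set T : ℝ := C₁ * (2 * (r : ℝ)) ^ (ε / 2) with hTdef
    have hC₁0 : 0 ≤ C₁ := zero_le_one.trans hC₁
    have hET : Real.exp (κ * psRate (R : ℝ)) ≤ T :=
      hE1.trans (mul_le_mul_of_nonneg_left
        (Real.rpow_le_rpow (Nat.cast_nonneg _) hRle (by positivity)) hC₁0)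
    have hT1 : 1 ≤ T :=
      one_le_mul_of_one_le_of_one_le hC₁ (Real.one_le_rpow (by linarith) (by positivity))
    -- logarithms
    have hMpos : (0 : ℝ) < M := by exact_mod_cast (show 0 < M by omega)
    have hApos : (0 : ℝ) < A := by exact_mod_cast hA
    set ℓ : ℝ := Real.log (M : ℝ) with hℓdef
    have hℓ0 : 0 ≤ ℓ := Real.log_nonneg (by exact_mod_cast (show 1 ≤ M by omega))
    have hlogA0 : 0 ≤ Real.log (A : ℝ) := Real.log_nonneg (by exact_mod_cast hA)
    have hden : 0 < logStar (Real.log (M : ℝ)) := lt_of_lt_of_le one_pos (one_le_logStar _)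
    have h1 : Real.log ((M : ℝ) / A) ≤ logStar (Real.log (M : ℝ)) * T := by
      have h := (div_le_iff₀ hden).mp (h22.trans hET)
      linarith [mul_comm T (logStar (Real.log (M : ℝ)))]
    rw [Real.log_div hMpos.ne' hApos.ne', logStar_def] at h1
    have h2 := absorb hlogA0 hT1 hℓ0 h1
    -- `log A ≤ 2 log (1 + |a|)`
    have habs : (0 : ℝ) < |(a : ℝ)| := by exact_mod_cast abs_pos.mpr ha
    have hAle : (A : ℝ) ≤ (a : ℝ) ^ 2 := by
      have := Int.le_of_dvd (by positivity) hAdvd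
      exact_mod_cast this
    have hlogA : Real.log (A : ℝ) ≤ 2 * Real.log (1 + |(a : ℝ)|) := by
      calc Real.log (A : ℝ) ≤ Real.log ((a : ℝ) ^ 2) := Real.log_le_log hApos hAle
        _ = Real.log (|(a : ℝ)| ^ 2) := by rw [sq_abs]
        _ = 2 * Real.log |(a : ℝ)| := by rw [Real.log_pow]; norm_num
        _ ≤ 2 * Real.log (1 + |(a : ℝ)|) := by
            have := Real.log_le_log habs (by linarith : |(a : ℝ)| ≤ 1 + |(a : ℝ)|)
            linarith
    -- `T² = C₁² 2^ε r^ε`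
    have hT2 : T ^ 2 = C₁ ^ 2 * (2 : ℝ) ^ ε * (r : ℝ) ^ ε := by
      have h2r : (0 : ℝ) ≤ 2 * r := by positivity
      rw [hTdef, mul_pow, ← Real.rpow_natCast ((2 * (r : ℝ)) ^ (ε / 2)) 2,
        ← Real.rpow_mul h2r, show ε / 2 * ((2 : ℕ) : ℝ) = ε by push_cast; ring,
        Real.mul_rpow (by norm_num) (Nat.cast_nonneg _)]
      ring
    -- `log Mz ≤ log 4 + ℓ`
    have hMzpos : (0 : ℝ) < ((max (4 * |b|) |a ^ 2 - 4 * b| : ℤ) : ℝ) := by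
      have : (0 : ℤ) < max (4 * |b|) |a ^ 2 - 4 * b| :=
        lt_of_lt_of_le (abs_pos.mpr hd) (le_max_right _ _)
      exact_mod_cast this
    have hMz : Real.log ((max (4 * |b|) |a ^ 2 - 4 * b| : ℤ) : ℝ) ≤ Real.log 4 + ℓ := by
      have hle : ((max (4 * |b|) |a ^ 2 - 4 * b| : ℤ) : ℝ) ≤ 4 * (M : ℝ) := by
        exact_mod_cast hMle
      calc Real.log ((max (4 * |b|) |a ^ 2 - 4 * b| : ℤ) : ℝ) ≤ Real.log (4 * (M : ℝ)) :=
            Real.log_le_log hMzpos hle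
        _ = Real.log 4 + ℓ := Real.log_mul (by norm_num) hMpos.ne'
    -- assembly
    calc Real.log ((max (4 * |b|) |a ^ 2 - 4 * b| : ℤ) : ℝ) ≤ Real.log 4 + ℓ := hMz
      _ ≤ Real.log 4 + (2 * Real.log (A : ℝ) + 16 * T ^ 2) := by linarith
      _ ≤ Real.log 4 * (r : ℝ) ^ ε + 4 * Real.log (1 + |(a : ℝ)|) +
            16 * (C₁ ^ 2 * (2 : ℝ) ^ ε * (r : ℝ) ^ ε) := by
          rw [← hT2]; nlinarith [hlog4, hrε, hlogA]
      _ = 4 * Real.log (1 + |(a : ℝ)|) +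
            (16 * C₁ ^ 2 * (2 : ℝ) ^ ε + Real.log 4) * (r : ℝ) ^ ε := by ring

end Summit.ABC.ABC.Theorems.TraceDefectPayoffLine
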